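import Literature.MathematicalPhysics.QuantumFieldTheory.LatticeGaugeProofs
import Summits.QuantumFields.YangMills.Theorems.EquipartitionCriticalityEquipartitionPinsProbeTangentHaarShiftSkew
import HarnessLib

/-!
# The skew Haar-shift identity for torus-limit states on `ℤ⁴`

Crux `stmt-QuantumFields-8760` (`EquipartitionPinsProbe`), line `Sketch`, stub `stub_haarShiftLimit`
(TS2): for `μ ∈ infiniteVolumeLimitPoints ρ β`, an edge `e`, a continuous cylinder `γ : U ↦ γ(U) ∈ G`
not reading `U_e` and a bounded continuous cylinder observable `F`,
`∫ F(update U e (γ(U)·U_e)) dμ = ∫ F(U) exp(−β (S_{{e}}(update U e (γ(U)⁻¹·U_e)) − S_{{e}}(U))) dμ`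
(and the right-multiplication analogue), `S_{{e}} = wilsonBoundaryAction ρ {e}`.

* the torus identity is the landed neighbour stub `stub_haarShiftSkew` (file
  `EquipartitionCriticalityEquipartitionPinsProbeTangentHaarShiftSkew`): on `(ℤ/M)^d`,
  `∫ f(update V e (γ'(V)·V_e)) dμ_β = ∫ f(V) exp(−β (S(update V e (γ'(V)⁻¹·V_e)) − S(V))) dμ_β` for
  measurable `γ'` not reading `V_e` (and the right-multiplication analogue).
* `TangentHaarShiftLimit.wilsonAction_update_sub` — updating ONE torus link changes the torus
  Wilson action exactly by the change of `S_{{e}}` of the periodic lift, once the projection is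
  injective on the plaquettes of `ℤ^d` through `e` (the other torus plaquettes do not contain the
  link, `mem_image_torusPlaq`).
* `TangentHaarShiftLimit.integral_shift_eq` — both sides are `μ`-integrals of bounded continuous
  cylinder observables, i.e. limits of torus expectations of their lifts, which agree on all large
  tori (`eventually_injOn_torusEdge`).

Reference: S. Chatterjee, arXiv:1803.01950, §2 (torus Wilson states and their limits).
-/

noncomputable section

open MeasureTheory Filter Topology
open Literature.MathematicalPhysics.QuantumLattice
open Literature.MathematicalPhysics.QuantumFieldTheory hiding ZdEdge IsLocalObservable IsInfiniteVolumeLimit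

namespace Summit.QuantumFields.YangMills.Theorems.EquipartitionPinsProbe

namespace TangentHaarShiftLimit

open Literature.Probability.LatticeModels (Torus.proj)

variable {d N : ℕ} {G : Type*} [Group G]

/-- The torus neighbour of a projected site is the projection of the `ℤ^d` neighbour. -/
theorem shift_torusProj (M : ℕ) (x : Literature.Probability.LatticeModels.Site d) (i : Fin d) :
    Site.shift (Torus.proj M x) i = Torus.proj M (x + Pi.single i 1) := by
  rw [torusProj_add_single, Int.cast_one]; rfl

/-- Projection mod `M` commutes with a backward unit step. -/
theorem torusProj_sub_single (M : ℕ) (x : Literature.Probability.LatticeModels.Site d) (i : Fin d) :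
    Torus.proj M (x - Pi.single i 1) = Torus.proj M x - Pi.single i 1 := by
  rw [sub_eq_add_neg, ← Pi.single_neg, torusProj_add_single, Int.cast_neg, Int.cast_one,
    Pi.single_neg, sub_eq_add_neg]

/-- The cost of the torus plaquette `(x mod M; i, j)` below the plaquette `p = (x; i, j)` of `ℤ^d`
is the `ℤ^d` plaquette energy of `p` in the periodic lift. -/
theorem plaquetteCost_torusProj (ρ : G →* Matrix (Fin N) (Fin N) ℂ) (M : ℕ) [NeZero M]
    (V : GaugeConfig d M G) (p : ZdPlaquette d) :
    plaquetteCost ρ V (Torus.proj M p.1, p.2) =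
      (N : ℝ) - plaquetteObs ρ p.1 p.2.1.1 p.2.1.2 (torusLift M V) := by
  simp only [plaquetteCost, plaquetteObs, plaquetteHolonomy, plaquetteHolonomyZd, shift_torusProj]
  rfl

omit [Group G] in
/-- Lifting after updating the torus link below `e` agrees with updating the lift at `e`, on every
edge `e'` that the projection separates from `e`. -/
theorem torusLift_update (M : ℕ) (V : GaugeConfig d M G) {e e' : ZdEdge d} (h : G)
    (hinj : torusEdge M e' = torusEdge M e → e' = e) :
    torusLift M (Function.update V (torusEdge M e) h) e' = Function.update (torusLift M V) e h e' := by
  by_cases he : e' = e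
  · subst he; simp [torusLift]
  · simp [torusLift, Function.update_of_ne he, Function.update_of_ne fun h' => he (hinj h')]

/-- A torus plaquette one of whose four links is the torus link below `e` is the projection of a
plaquette of `ℤ^d` containing `e` (no largeness of `M` needed). -/
theorem mem_image_torusPlaq (M : ℕ) (e : ZdEdge d) (q : Plaquette d M)
    (h : torusEdge M e = (q.1, q.2.1.1) ∨ torusEdge M e = (Site.shift q.1 q.2.1.1, q.2.1.2) ∨
      torusEdge M e = (Site.shift q.1 q.2.1.2, q.2.1.1) ∨ torusEdge M e = (q.1, q.2.1.2)) :
    q ∈ (plaquettesTouching {e}).image fun p : ZdPlaquette d => (Torus.proj M p.1, p.2) := by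
  obtain ⟨x, k⟩ := e
  obtain ⟨y, ij⟩ := q
  simp only [torusEdge, Site.shift, Prod.mk.injEq] at h
  rw [Finset.mem_image]
  have touch : ∀ z : Literature.Probability.LatticeModels.Site d, (x, k) ∈ plaquetteEdges (z, ij) →
      ((z, ij) : ZdPlaquette d) ∈ plaquettesTouching {(x, k)} := fun z hz =>
    mem_plaquettesTouching_iff.2 ⟨(x, k), Finset.mem_inter.2 ⟨hz, by simp⟩⟩
  rcases h with ⟨hy, hk⟩ | ⟨hy, hk⟩ | ⟨hy, hk⟩ | ⟨hy, hk⟩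
  · exact ⟨(x, ij), touch x (by simp [plaquetteEdges, hk]), by simp [hy]⟩
  · exact ⟨(x - Pi.single ij.1.1 1, ij), touch _ (by simp [plaquetteEdges, hk]),
      by simp only [torusProj_sub_single, hy, add_sub_cancel_right]⟩
  · exact ⟨(x - Pi.single ij.1.2 1, ij), touch _ (by simp [plaquetteEdges, hk]),
      by simp only [torusProj_sub_single, hy, add_sub_cancel_right]⟩
  · exact ⟨(x, ij), touch x (by simp [plaquetteEdges, hk]), by simp [hy]⟩

/-- Updating the torus link below `e` does not change the holonomy of a torus plaquette that is not
the projection of a plaquette of `ℤ^d` containing `e`. -/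
theorem plaquetteHolonomy_update_of_not_mem (M : ℕ) (e : ZdEdge d) {q : Plaquette d M}
    (hq : q ∉ (plaquettesTouching {e}).image fun p : ZdPlaquette d => (Torus.proj M p.1, p.2))
    (V : GaugeConfig d M G) (h : G) :
    plaquetteHolonomy (Function.update V (torusEdge M e) h) q.1 q.2.1.1 q.2.1.2 =
      plaquetteHolonomy V q.1 q.2.1.1 q.2.1.2 := by
  have H := fun E (hE : torusEdge M e = E → _) (h' : E = torusEdge M e) =>
    hq (mem_image_torusPlaq M e q (hE h'.symm))
  simp only [plaquetteHolonomy, Function.update_of_ne (H _ Or.inl),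
    Function.update_of_ne (H _ fun h => Or.inr (Or.inl h)),
    Function.update_of_ne (H _ fun h => Or.inr (Or.inr (Or.inl h))),
    Function.update_of_ne (H _ fun h => Or.inr (Or.inr (Or.inr h)))]

/-- **The one-link change of the torus Wilson action is the one-link change of the boundary Wilson
action `S_{{e}}` of the lift**, once the projection is injective on the plaquettes through `e`. -/
theorem wilsonAction_update_sub (ρ : G →* Matrix (Fin N) (Fin N) ℂ) (M : ℕ) [NeZero M]
    (e : ZdEdge d)
    (hinj : Set.InjOn (fun p : ZdPlaquette d => ((Torus.proj M p.1, p.2) : Plaquette d M))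
      (plaquettesTouching {e} : Finset (ZdPlaquette d)))
    (V : GaugeConfig d M G) (h : G) :
    wilsonAction ρ (Function.update V (torusEdge M e) h) - wilsonAction ρ V =
      wilsonBoundaryAction ρ {e} (torusLift M (Function.update V (torusEdge M e) h)) -
        wilsonBoundaryAction ρ {e} (torusLift M V) := by
  set Q := (plaquettesTouching {e}).image fun p : ZdPlaquette d =>
    ((Torus.proj M p.1, p.2) : Plaquette d M) with hQdef
  have hsplit : ∀ W : GaugeConfig d M G, wilsonAction ρ W =
      wilsonBoundaryAction ρ {e} (torusLift M W) +
        ∑ q ∈ Finset.univ.filter (fun q => q ∉ Q), plaquetteCost ρ W q := by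
    intro W
    change ∑ q, plaquetteCost ρ W q = _
    rw [← Finset.sum_filter_add_sum_filter_not Finset.univ (fun q => q ∈ Q)]
    congr 1
    rw [show Finset.univ.filter (fun q => q ∈ Q) = Q by ext q; simp, hQdef, Finset.sum_image hinj]
    exact Finset.sum_congr rfl fun p _ => plaquetteCost_torusProj ρ M W p
  rw [hsplit, hsplit V, Finset.sum_congr rfl fun q hq => by
    rw [plaquetteCost, plaquetteHolonomy_update_of_not_mem M e (Finset.mem_filter.1 hq).2 V h]]
  unfold plaquetteCost
  ring

/-- Injectivity of the projection on the edges of a family of plaquettes gives injectivity on the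
plaquettes. -/
theorem injOn_torusPlaq (M : ℕ) {P : Finset (ZdPlaquette d)} {T : Finset (ZdEdge d)}
    (hinj : Set.InjOn (torusEdge (d := d) M) T) (hPT : P.biUnion plaquetteEdges ⊆ T) :
    Set.InjOn (fun p : ZdPlaquette d => ((Torus.proj M p.1, p.2) : Plaquette d M)) P := by
  intro p₁ hp₁ p₂ hp₂ hp
  simp only [Prod.mk.injEq] at hp
  have hm : ∀ p ∈ (P : Set (ZdPlaquette d)), (p.1, p.2.1.1) ∈ (T : Set (ZdEdge d)) := fun p hp =>
    hPT (Finset.mem_biUnion.2 ⟨p, hp, by simp [plaquetteEdges]⟩)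
  have key : ((p₁.1, p₁.2.1.1) : ZdEdge d) = (p₂.1, p₂.2.1.1) := hinj (hm p₁ hp₁) (hm p₂ hp₂)
    (by change (Torus.proj M p₁.1, p₁.2.1.1) = (Torus.proj M p₂.1, p₂.2.1.1); rw [hp.1, hp.2])
  exact Prod.ext (Prod.mk.inj key).1 hp.2

variable [TopologicalSpace G] [IsTopologicalGroup G] [CompactSpace G] [MeasurableSpace G]
  [BorelSpace G] (ρ : G →* Matrix (Fin N) (Fin N) ℂ)

omit [MeasurableSpace G] [BorelSpace G] in
/-- The boundary Wilson action of a continuous representation is continuous and bounded. -/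
theorem continuous_bounded_boundaryAction (hρ : Continuous ρ) (Λ : Finset (ZdEdge d)) :
    Continuous (wilsonBoundaryAction (G := G) ρ Λ) ∧
      ∃ B : ℝ, ∀ U : LGConfig d G, |wilsonBoundaryAction ρ Λ U| ≤ B := by
  have hc : Continuous (wilsonBoundaryAction (G := G) ρ Λ) := by
    unfold wilsonBoundaryAction
    exact continuous_finsetSum _ fun p _ => continuous_const.sub (continuous_plaquetteObs ρ hρ _ _ _)
  obtain ⟨B, hB⟩ := isCompact_univ.exists_bound_of_continuousOn hc.continuousOn
  exact ⟨hc, B, fun U => by simpa [Real.norm_eq_abs] using hB U (Set.mem_univ U)⟩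

/-- **Transfer to torus-limit states.** For a continuous "multiplication pattern" `op`
(`op g u = g u` or `u g`) and the torus skew-shift identity `htorus` for it, both sides of the
claimed identity are integrals of bounded continuous cylinder observables `H₁, H₂`, hence limits of
the torus expectations of their lifts; on every torus so large that the projection separates the
relevant finite edge set `T`, the lifted identity IS the torus identity for `f := F ∘ torusLift`,
`γ' := γ ∘ torusLift` (the lift of an updated torus configuration agrees on `T` with the updated
lift, `torusLift_update`, and the action changes agree by `wilsonAction_update_sub`). -/
theorem integral_shift_eq [SecondCountableTopology G] (hρ : Continuous ρ) {β : ℝ} {L : ℕ → ℕ}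
    (hL : StrictMono L) {μ : Measure (LGConfig d G)} (hμ : IsInfiniteVolumeLimitAlong ρ β L μ)
    (e : ZdEdge d) {γ : LGConfig d G → G} {Sγ : Finset (ZdEdge d)} (hγS : IsCylinder γ Sγ)
    (hγc : Continuous γ) (hγe : ∀ U g, γ (Function.update U e g) = γ U)
    {F : LGConfig d G → ℝ} {SF : Finset (ZdEdge d)} (hFS : IsCylinder F SF) (hFc : Continuous F)
    (hFb : ∃ C : ℝ, ∀ U, |F U| ≤ C) (op : G → G → G) (hop : Continuous fun p : G × G => op p.1 p.2)
    (htorus : ∀ (M : ℕ) [NeZero M] (γ' : GaugeConfig d M G → G), Measurable γ' →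
      (∀ V g, γ' (Function.update V (torusEdge M e) g) = γ' V) → ∀ f : GaugeConfig d M G → ℝ,
      ∫ V, f (Function.update V (torusEdge M e) (op (γ' V) (V (torusEdge M e)))) ∂(wilsonMeasure ρ β) =
        ∫ V, f V * Real.exp (-(β * (wilsonAction ρ (Function.update V (torusEdge M e)
          (op (γ' V)⁻¹ (V (torusEdge M e)))) - wilsonAction ρ V))) ∂(wilsonMeasure ρ β)) :
    ∫ U, F (Function.update U e (op (γ U) (U e))) ∂μ =
      ∫ U, F U * Real.exp (-(β * (wilsonBoundaryAction ρ {e} (Function.update U e (op (γ U)⁻¹ (U e))) -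
        wilsonBoundaryAction ρ {e} U))) ∂μ := by
  obtain ⟨-, hconv⟩ := hμ
  obtain ⟨C, hC⟩ := hFb
  obtain ⟨hSc, B, hB⟩ := continuous_bounded_boundaryAction ρ hρ ({e} : Finset (ZdEdge d))
  set P : Finset (ZdEdge d) := (plaquettesTouching {e}).biUnion plaquetteEdges with hP
  set T : Finset (ZdEdge d) := insert e (SF ∪ Sγ ∪ P) with hT
  have heT : e ∈ T := Finset.mem_insert_self _ _
  have hSF : SF ⊆ T := Finset.subset_union_left.trans (Finset.subset_union_left.trans (Finset.subset_insert _ _))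
  have hSγ : Sγ ⊆ T := Finset.subset_union_right.trans (Finset.subset_union_left.trans (Finset.subset_insert _ _))
  have hPT : P ⊆ T := Finset.subset_union_right.trans (Finset.subset_insert _ _)
  -- updates of `T`-agreeing configurations agree on `T`
  have hagree : ∀ {U V : LGConfig d G}, (∀ e' ∈ (T : Set (ZdEdge d)), U e' = V e') → ∀ (g : G),
      ∀ e' ∈ (T : Set (ZdEdge d)), Function.update U e g e' = Function.update V e g e' := by
    intro U V hUV g e' he'
    by_cases h : e' = e
    · subst h; simp
    · rw [Function.update_of_ne h, Function.update_of_ne h, hUV e' he']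
  have hupd : ∀ {φ : LGConfig d G → G}, Continuous φ →
      Continuous fun U : LGConfig d G => Function.update U e (φ U) := fun hφ => continuous_id.update e hφ
  -- the two observables are bounded continuous cylinder observables on `T`: their limits
  have t₁ := hconv (fun U => F (Function.update U e (op (γ U) (U e)))) T
    (fun U V hUV => by
      have hγUV : γ U = γ V := hγS fun e' he' => hUV e' (hSγ he')
      simp only [hγUV, hUV e heT]
      exact hFS fun e' he' => hagree hUV _ e' (hSF he'))
    (hFc.comp (hupd (hop.comp (hγc.prodMk (continuous_apply e))))) ⟨C, fun U => hC _⟩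
  have t₂ := hconv (fun U => F U * Real.exp (-(β * (wilsonBoundaryAction ρ {e}
      (Function.update U e (op (γ U)⁻¹ (U e))) - wilsonBoundaryAction ρ {e} U)))) T
    (fun U V hUV => by
      have hγUV : γ U = γ V := hγS fun e' he' => hUV e' (hSγ he')
      have hS₁ := isCylinder_wilsonBoundaryAction_holds ρ {e} fun e' he' => hUV e' (hPT he')
      have hS₂ := isCylinder_wilsonBoundaryAction_holds ρ {e} fun e' he' =>
        hagree hUV (op (γ V)⁻¹ (V e)) e' (hPT he')
      simp only [hγUV, hUV e heT, hFS fun e' he' => hUV e' (hSF he'), hS₁, hS₂])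
    (hFc.mul (Real.continuous_exp.comp ((continuous_const.mul
      ((hSc.comp (hupd (hop.comp (hγc.inv.prodMk (continuous_apply e))))).sub hSc)).neg)))
    ⟨C * Real.exp (|β| * (B + B)), fun U => by
      rw [abs_mul, Real.abs_exp]
      refine mul_le_mul (hC U) (Real.exp_le_exp.2 ((neg_le_abs _).trans ?_)) (Real.exp_pos _).le
        ((abs_nonneg _).trans (hC U))
      rw [abs_mul]
      exact mul_le_mul_of_nonneg_left ((abs_sub _ _).trans (add_le_add (hB _) (hB _)))
        (abs_nonneg _)⟩
  refine tendsto_nhds_unique (t₁.congr' ?_) t₂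
  -- the torus expectations agree on all large tori
  filter_upwards [hL.tendsto_atTop.eventually (eventually_injOn_torusEdge T)] with k hinj
  have hlift : ∀ (V : GaugeConfig d (L k + 1) G) (g : G), ∀ e' ∈ (T : Set (ZdEdge d)),
      torusLift (L k + 1) (Function.update V (torusEdge (L k + 1) e) g) e' =
        Function.update (torusLift (L k + 1) V) e g e' :=
    fun V g e' he' => torusLift_update (L k + 1) V g fun h => hinj he' heT h
  have hγ : ∀ (V : GaugeConfig d (L k + 1) G) (g : G),
      γ (torusLift (L k + 1) (Function.update V (torusEdge (L k + 1) e) g)) = γ (torusLift (L k + 1) V) :=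
    fun V g => by rw [hγS fun e' he' => hlift V g e' (hSγ he'), hγe]
  have key := htorus (L k + 1) (γ ∘ torusLift (L k + 1)) (hγc.measurable.comp (measurable_torusLift _))
    (fun V g => hγ V g) (toTorusObservable (L k + 1) F)
  simp only [Function.comp_apply, toTorusObservable_apply] at key
  unfold wilsonExpectation
  simp only [toTorusObservable_apply]
  calc ∫ V, F (Function.update (torusLift (L k + 1) V) e (op (γ (torusLift (L k + 1) V))
          (torusLift (L k + 1) V e))) ∂(wilsonMeasure ρ β)
      = ∫ V, F (torusLift (L k + 1) (Function.update V (torusEdge (L k + 1) e)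
          (op (γ (torusLift (L k + 1) V)) (V (torusEdge (L k + 1) e))))) ∂(wilsonMeasure ρ β) :=
        integral_congr_ae (ae_of_all _ fun V => hFS fun e' he' => (hlift V _ e' (hSF he')).symm)
    _ = _ := key
    _ = _ := integral_congr_ae (ae_of_all _ fun V => by
        beta_reduce
        rw [wilsonAction_update_sub ρ (L k + 1) e (injOn_torusPlaq (L k + 1) hinj hPT) V,
          isCylinder_wilsonBoundaryAction_holds ρ {e} fun e' he' => hlift V _ e' (hPT he')]
        rfl)

end TangentHaarShiftLimit

/-- **STUB TS2 — the skew Haar-shift identity for torus-limit states on `ℤ⁴`.** For every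
`μ ∈ infiniteVolumeLimitPoints ρ β`, every edge `e`, every continuous cylinder `γ : configurations → G`
not reading `U_e`, and every bounded continuous cylinder observable `F`,
`∫ F(update U e (γ(U) U_e)) dμ = ∫ F(U) exp(−β (S_{{e}}(update U e (γ(U)⁻¹ U_e)) − S_{{e}}(U))) dμ`
and the right-multiplication analogue, `S_{{e}}` the boundary Wilson action of `{e}` (the
plaquettes through `e`): both sides are limits of torus expectations of bounded continuous cylinder
observables, and on a large torus the lifted identity is the torus skew-shift identity (the
neighbour stub `stub_haarShiftSkew`), because updating one torus link changes the torus action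
exactly by the change of `S_{{e}}` of the lift (`TangentHaarShiftLimit.wilsonAction_update_sub`). -/
theorem stub_haarShiftLimit :
    ∀ (G : Type) [Group G] [TopologicalSpace G] [IsTopologicalGroup G] [CompactSpace G] [T2Space G]
      [SecondCountableTopology G] [MeasurableSpace G] [BorelSpace G] {N : ℕ}
      (ρ : G →* Matrix (Fin N) (Fin N) ℂ), Continuous ρ →
      ∀ (β : ℝ) (μ : MeasureTheory.Measure (Literature.MathematicalPhysics.QuantumLattice.LGConfig 4 G)),
        μ ∈ Literature.MathematicalPhysics.QuantumLattice.infiniteVolumeLimitPoints (d := 4) ρ β →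
        ∀ (e : Literature.MathematicalPhysics.QuantumLattice.ZdEdge 4) (γ : Literature.MathematicalPhysics.QuantumLattice.LGConfig 4 G → G) (Sγ : Finset (Literature.MathematicalPhysics.QuantumLattice.ZdEdge 4)),
          Literature.MathematicalPhysics.QuantumLattice.IsCylinder γ Sγ → Continuous γ → (∀ (U : Literature.MathematicalPhysics.QuantumLattice.LGConfig 4 G) (g : G), γ (Function.update U e g) = γ U) →
          ∀ (F : Literature.MathematicalPhysics.QuantumLattice.LGConfig 4 G → ℝ) (SF : Finset (Literature.MathematicalPhysics.QuantumLattice.ZdEdge 4)),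
            Literature.MathematicalPhysics.QuantumLattice.IsCylinder F SF → Continuous F → (∃ C : ℝ, ∀ U, |F U| ≤ C) →
            (∫ U, F (Function.update U e (γ U * U e)) ∂μ =
              ∫ U, F U * Real.exp (-(β * (Literature.MathematicalPhysics.QuantumLattice.wilsonBoundaryAction ρ {e}
                  (Function.update U e ((γ U)⁻¹ * U e)) - Literature.MathematicalPhysics.QuantumLattice.wilsonBoundaryAction ρ {e} U))) ∂μ) ∧
            (∫ U, F (Function.update U e (U e * γ U)) ∂μ =
              ∫ U, F U * Real.exp (-(β * (Literature.MathematicalPhysics.QuantumLattice.wilsonBoundaryAction ρ {e}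
                  (Function.update U e (U e * (γ U)⁻¹)) - Literature.MathematicalPhysics.QuantumLattice.wilsonBoundaryAction ρ {e} U))) ∂μ) := by
  intro G _ _ _ _ _ _ _ _ N ρ hρ β μ hμ e γ Sγ hγS hγc hγe F SF hFS hFc hFb
  obtain ⟨L, hL, hlim⟩ := hμ
  exact ⟨TangentHaarShiftLimit.integral_shift_eq ρ hρ hL hlim e hγS hγc hγe hFS hFc hFb (· * ·)
      continuous_mul fun M _ γ' hγ'm hγ'e f => (stub_haarShiftSkew G ρ hρ 4 M β _ γ' hγ'm hγ'e f).1,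
    TangentHaarShiftLimit.integral_shift_eq ρ hρ hL hlim e hγS hγc hγe hFS hFc hFb (fun g u => u * g)
      (continuous_snd.mul continuous_fst)
      fun M _ γ' hγ'm hγ'e f => (stub_haarShiftSkew G ρ hρ 4 M β _ γ' hγ'm hγ'e f).2⟩

end Summit.QuantumFields.YangMills.Theorems.EquipartitionPinsProbe

end
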